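import Summits.BirchSwinnertonDyer.BirchSwinnertonDyer.Theorems.Rank1ResidualJetThm63KernelInputs
import Literature.NumberTheory.EllipticCurves.HeegnerPointsOfConductorRationalityProofs
import Literature.NumberTheory.EllipticCurves.RingClassGalOverCyclicProofs
import HarnessLib

/-!
# T1 JET (cell `bsd-jet`), road K: the two Gross 1991 §3 CM inputs of the H63 assembly DISCHARGED by
# the tree's proofs — `tamagawaExponent_le_mInfty_of_kernelInputs` without `hCM1` / `hCM2`

HONEST FRAMING (programme file §HONESTY, verbatim): «no tranche here proves BSD; ARM L moves the
LITERAL column of an r ≤ 1 census into the kernel-proved-modulo-named-print column.» THEOREMS ONLY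
(seat `bsd-jet-pv-2`, session g3; `--supports stmt-BirchSwinnertonDyer-14418`, helper); 0 classes
move. The assembly `JET.tamagawaExponent_le_mInfty_of_kernelInputs` (sibling file) takes the CM facts
`phi_heegnerPointOfConductor_mem_range_map_ringClassField N_E W K` (Gross 1991 §3: `y(n) ∈ E(K[n])`)
and `exists_generator_ringClassGalOver K` (Gross 1991 §3: `G_ℓ` cyclic) as named hypotheses; BOTH are
PROVED in the tree (`phi_heegnerPointOfConductor_mem_range_map_ringClassField_holds`,
`HeegnerPointsOfConductorRationalityProofs`; `exists_generator_ringClassGalOver_holds`,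
`RingClassGalOverCyclicProofs`). This file records the assembly with the two inputs supplied, so that
the named-print list of road K's H63 line reads exactly {[McC] Prop. 4.4 (typed), Gross 1991 Prop. 5.3
(`h53`), [GZ86 III (3.1)] (`hGZ`)} plus the kernel gaps {`htr`, `hT`, `h49str`, `h49tr`, `hdual_q`,
`hdual_ℓ`}. References: [cite: GrossLMS1991, §3 (pp. 238–239)] [cite: Darmon2004, Thm. 3.6]
[cite: Jetchev2008, Thm. 5.2 (p. 821)].
-/

set_option autoImplicit false

noncomputable section

open scoped Classical

open WeierstrassCurve IsDedekindDomain NumberField Literature.NumberTheory.EllipticCurves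
  Literature.NumberTheory.EllipticCurves.ModularForms Literature.NumberTheory.EllipticCurves.Jetchev2008
  Literature.NumberTheory.GaloisRepresentations
  Literature.NumberTheory.GaloisRepresentations.DiscreteGaloisModule
  Summit.BirchSwinnertonDyer.Rank1Residual.X11b

namespace Summit.BirchSwinnertonDyer.Rank1Residual.JET

/-- **[J] Thm 5.2 at a core vertex with the kernel bricks plugged in and the Gross §3 CM inputs
PROVED** — `tamagawaExponent_le_mInfty_of_kernelInputs` with `hCM1 :=
phi_heegnerPointOfConductor_mem_range_map_ringClassField_holds`, `hCM2 :=
exists_generator_ringClassGalOver_holds`. Remaining named print: `h44`, `h53`, `hGZ`; remaining kernel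
gaps: `htr`, `hT`, `h49str`, `h49tr`, `hdual_q`, `hdual_ℓ`. CONCLUSION: `t ≤ m_∞`.
[cite: Jetchev2008, Thm. 5.2 (p. 821) and proof] [cite: GrossLMS1991, §3 (pp. 238–239)]
[cite: Darmon2004, Thm. 3.6] -/
theorem tamagawaExponent_le_mInfty_of_kernelInputs'
    (h44 : McCallum1991.prop44_localOrder_kolyvaginClass_mul_eq)
    (W : WeierstrassCurve ℚ) [W.IsElliptic] [W.IsGloballyMinimal] [NeZero (W.conductorNorm ℤ)]
    (hcm : ¬ W.HasCM) (K : Type) [Field K] [NumberField K] (hK : IsImaginaryQuadratic K)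
    (hD3 : NumberField.discr K ≠ -3) (hD4 : NumberField.discr K ≠ -4)
    (hH : SatisfiesHeegnerHypothesis (W.conductorNorm ℤ) K)
    (p : ℕ) [Fact p.Prime] (hp2 : p ≠ 2) (htower : ∀ n : ℕ, W.HasSurjectiveModNGaloisRep (p ^ n : ℕ))
    (Dt : ModularParametrizationData W (W.conductorNorm ℤ)) (β : ℤ) (ι : K →+* ℂ)
    [∀ j : ℕ, NumberField (ringClassField K ι j)]
    (τ : K ≃ₐ[ℚ] K) (hτ : τ ≠ 1)
    (ε : ℤ) (hε : ε = 1 ∨ ε = -1)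
    (h53 : ∀ (m : ℕ) (dm : KolyvaginHeegnerData Dt β ι m)
      (τm : ringClassField K ι m ≃ₐ[ℚ] ringClassField K ι m),
      (∀ x : ringClassField K ι m, ((τm x : ringClassField K ι m) : ℂ) = starRingEnd ℂ x) →
      ∃ σ' ∈ ringClassGal ι m, IsOfFinAddOrder
        (pointGalHom W (ringClassField K ι m) τm dm.y -
          ε • pointGalHom W (ringClassField K ι m) σ' dm.y))
    {n' : ℤ} (hcop' : IsCoprime (p : ℤ) n')
    (hGZ : ∀ (m : ℕ) (dm : KolyvaginHeegnerData Dt β ι m)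
      (γ : ringClassField K ι m ≃ₐ[ℚ] ringClassField K ι m), γ ∈ ringClassGal ι m →
      ∀ v : HeightOneSpectrum (𝓞 K), ¬ (W.baseChange K).HasGoodReductionAt v →
        n' • pointsMap (W.baseChange K) (v.adicCompletion K)
            (dm.toGeomPoints (pointGalHom W (ringClassField K ι m) γ dm.y)) ∈
          E0Receptacle (W.baseChange K) v ∧
        ∀ (ℓ : ℕ), ℓ ∈ m.primeFactors → ∀ (dm' : KolyvaginHeegnerData Dt β ι (m / ℓ))
          (hle : ringClassField K ι (m / ℓ) ≤ ringClassField K ι m),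
          n' • pointsMap (W.baseChange K) (v.adicCompletion K)
              (dm.toGeomPoints (pointGalHom W (ringClassField K ι m) γ
                (WeierstrassCurve.Affine.Point.map (W' := W)
                  ((RingClassField.inclusion ι hle).restrictScalars ℚ) dm'.y))) ∈
            E0Receptacle (W.baseChange K) v)
    (mdiv m : {c : ℕ // Squarefree c ∧ ∀ ℓ ∈ c.primeFactors,
        Zhang2014.IsKolyvaginPrime (W.conductorNorm ℤ) W K p ℓ} → ℕ∞)
    (hmdiv : ∀ c (u : ℕ), (u : ℕ∞) ≤ mdiv c ↔ ∀ d : KolyvaginHeegnerData Dt β ι c.1,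
      ∃ Q : (W.baseChange (ringClassField K ι c.1)).toAffine.Point,
        ((p ^ u : ℕ) : ℤ) • Q = d.derivedPoint)
    (hm : ∀ c, m c = if mdiv c < Zhang2014.levelIndex W p c.1 then mdiv c else ⊤)
    (k : ℕ) (c : {c : ℕ // Squarefree c ∧ ∀ ℓ ∈ c.primeFactors,
        Zhang2014.IsKolyvaginPrime (W.conductorNorm ℤ) W K p ℓ}) (hk : 1 ≤ k)
    (hcore : IsGlobalCoreVertex W K ι τ p k c.1) (mInf : ℕ) (hmc : m c = mInf)
    (hkM : (k : ℕ∞) + mInf ≤ Zhang2014.levelIndex W p c.1)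
    (t : ℕ) (htk : t < k) (hik : mInf < k)
    (𝒯 𝒮 : SelmerStructure ((W.baseChange K).torsionGaloisModule ((p ^ k : ℕ) : ℤ)))
    (hT : ∀ x : galoisCohomology ((W.baseChange K).torsionGaloisModule ((p ^ k : ℕ) : ℤ)) 1,
      (∀ w ∈ placesDividing K c.1,
        galoisCohomology.localization ((W.baseChange K).torsionGaloisModule ((p ^ k : ℕ) : ℤ))
          (Sum.inr w) 1 x ∈ 𝒯 (Sum.inr w)) ↔
      ∀ ℓ ∈ c.1.primeFactors, x ∈ transverseKer W K ι ((p ^ k : ℕ) : ℤ) ℓ)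
    (hS : ∀ v, 𝒮 v ≤ (W.baseChange K).kummerSelmerStructure ((p ^ k : ℕ) : ℤ) v)
    (Qcar : Finset (HeightOneSpectrum (𝓞 K))) (hQcar : Disjoint Qcar (placesDividing K c.1))
    (e' : ℤ) (he' : e' = ε * (-1) ^ c.1.primeFactors.card)
    (C' : AddSubgroup (galH1Torsion (W.baseChange K) ((p ^ k : ℕ) : ℤ)))
    (hC : C' ≤ signPart W K τ ((p ^ k : ℕ) : ℤ) (-e') ⊤)
    (htr : ∀ (d : KolyvaginHeegnerData Dt β ι c.1), ∀ ℓ ∈ c.1.primeFactors,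
      (d.kolyvaginClass (Fact.out : p.Prime) k :
        galoisCohomology ((W.baseChange K).torsionGaloisModule ((p ^ k : ℕ) : ℤ)) 1) ∈
        transverseKer W K ι ((p ^ k : ℕ) : ℤ) ℓ)
    (hdual_q : ∃ (Qg Qg' : Type) (_ : AddCommGroup Qg) (_ : AddCommGroup Qg') (_ : Finite Qg')
      (locq : signPart W K τ ((p ^ k : ℕ) : ℤ) (-e')
        (modifiedSelmerGroup W K ι ((p ^ k : ℕ) : ℤ) c.1) →+ Qg)
      (locq' : C' →+ Qg'),
      (∀ x : C', locq' x = 0 ↔ (x : galH1Torsion (W.baseChange K) ((p ^ k : ℕ) : ℤ)) ∈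
        signPart W K τ ((p ^ k : ℕ) : ℤ) (-e') (modifiedSelmerGroup W K ι ((p ^ k : ℕ) : ℤ) c.1)) ∧
      Nat.card locq.range * Nat.card locq'.range = Nat.card Qg' ∧ IsAddCyclic Qg' ∧ Nat.card Qg' = p ^ t)
    (h49str : ∀ (ℓ : ℕ), Zhang2014.IsKolyvaginPrime (W.conductorNorm ℤ) W K p ℓ →
      k ≤ Zhang2014.kolyvaginIndex W p ℓ → ℓ ∉ c.1.primeFactors →
      ∀ (d' : KolyvaginHeegnerData Dt β ι (c.1 * ℓ)), ∀ q ∈ Qcar,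
      galoisCohomology.localization ((W.baseChange K).torsionGaloisModule ((p ^ k : ℕ) : ℤ))
          (Sum.inr q) 1 (d'.kolyvaginClass (Fact.out : p.Prime) k) ∈ 𝒮 (Sum.inr q))
    (h49tr : ∀ (ℓ : ℕ), Zhang2014.IsKolyvaginPrime (W.conductorNorm ℤ) W K p ℓ →
      k ≤ Zhang2014.kolyvaginIndex W p ℓ → ℓ ∉ c.1.primeFactors →
      ∀ (d' : KolyvaginHeegnerData Dt β ι (c.1 * ℓ)), ∀ w ∈ placesDividing K c.1,
      galoisCohomology.localization ((W.baseChange K).torsionGaloisModule ((p ^ k : ℕ) : ℤ))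
          (Sum.inr w) 1 (d'.kolyvaginClass (Fact.out : p.Prime) k) ∈ 𝒯 (Sum.inr w))
    (hdual_ℓ : ∀ (ℓ : ℕ), Zhang2014.IsKolyvaginPrime (W.conductorNorm ℤ) W K p ℓ →
      k ≤ Zhang2014.kolyvaginIndex W p ℓ → ℓ ∉ c.1.primeFactors →
      ∀ (v : HeightOneSpectrum (𝓞 K)), (ℓ : 𝓞 K) ∈ v.asIdeal →
      ∃ (Sg : Type) (_ : AddCommGroup Sg)
        (sing : signPart W K τ ((p ^ k : ℕ) : ℤ) (-e')
          (((selmerF0 W ((p ^ k : ℕ) : ℤ) 𝒯 𝒮 (placesDividing K c.1) Qcar).relaxedAt {v}).selmerGroup) →+ Sg),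
        (∀ x, sing x = 0 ↔ (x : galoisCohomology ((W.baseChange K).torsionGaloisModule ((p ^ k : ℕ) : ℤ)) 1) ∈
          signPart W K τ ((p ^ k : ℕ) : ℤ) (-e')
            ((selmerF0 W ((p ^ k : ℕ) : ℤ) 𝒯 𝒮 (placesDividing K c.1) Qcar).selmerGroup)) ∧
        Nat.card sing.range *
          Nat.card (C'.map (galoisCohomology.localization
            ((W.baseChange K).torsionGaloisModule ((p ^ k : ℕ) : ℤ)) (Sum.inr v) 1 :
              galH1Torsion (W.baseChange K) ((p ^ k : ℕ) : ℤ) →+ _)) = p ^ k) :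
    t ≤ mInf :=
  tamagawaExponent_le_mInfty_of_kernelInputs h44 W hcm K hK hD3 hD4 hH
    (phi_heegnerPointOfConductor_mem_range_map_ringClassField_holds (W.conductorNorm ℤ) W K)
    exists_generator_ringClassGalOver_holds p hp2 htower Dt β ι τ hτ ε hε h53 hcop' hGZ mdiv m
    hmdiv hm k c hk hcore mInf hmc hkM t htk hik 𝒯 𝒮 hT hS Qcar hQcar e' he' C' hC htr hdual_q h49str
    h49tr hdual_ℓ

end Summit.BirchSwinnertonDyer.Rank1Residual.JET

end
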